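import Summits.Ventures.HodgeRepro2.T5RecordSphericalSpectrumIntrinsic
import Summits.Ventures.HodgeRepro2.T5RecordSatakeInertToyDegree

/-!
# The unramified spectrum of the record's pair at the inert place `(3)` of `ℚ(i)`, as a numeral

Tier-5 support N3 / §G-N4.2 (seat p3, gen 86). File 344 gives, at every place `v` of `K⁺` that stays prime in the
CM field `K` (`v 𝓞_K = w`) and is good for the Gram matrix `H`, and for any `q'` equal to `N(v)`: `u₀ ∈ 𝒪_{K⁺_v}ˣ`, an
isomorphism `Φ : U(J₃(u₀)) ≃* U(1 ⊗ H)` matching the hyperspecial subgroups, a star-fixed uniformiser `ϖ'`, such that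
every irreducible `K_v`-finite representation of `U(1 ⊗ H)` with non-zero finite-dimensional `K_v`-invariants is
`≅ (inertSphericalQuot (α q'⁻²)) ∘ Φ⁻¹` for some `α ≠ 0`. This file reads it at the concrete inert place `(3)` of
`L = ℚ(ζ₄) = ℚ(i)` (file 238's `vThreePlus`, with `N(v) = 3` by file 249's `absNorm_vThreePlus`) and the Gram matrix
`H₀ = diag(1, 1, −1)` of file 237, so that the Satake parameter reads `α · (3²)⁻¹ = α / 9`:

* `zeta_sq` — `ζ₄² = −1`; `neg_one_eq_zeta_sq`, `complexConj_zeta_ne` — the explicit datum `(θ, y) = (−1, ζ₄)`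
  of the CM field `ℚ(i)` (`−1 = ζ₄²` in `L`, `ζ₄` not fixed by complex conjugation: it is not real under any
  complex embedding);
* **`exists_mulEquiv_forall_nonempty_equiv_inertSphericalQuot_record_three`** — file 344's theorem at `(3)` of
  `ℚ(i)` for any datum `(θ, y)` and any generators `l`, with `q' = 3`;
* **`exists_mulEquiv_forall_nonempty_equiv_inertSphericalQuot_record_three_zeta`** — the same with the explicit
  datum `(−1, ζ₄)`;
* `exists_generators_and_…` — with the generators `l` supplied by file 235.

In the `Spectrum` section the number-field and CM-field structures of `L` are section instances (`Prop`-valued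
classes, inhabited by file 238's `numberField L` and p8's `isCMField_four L`); the forms with those instances
supplied inside the statement are file 346 (`T5RecordSphericalSpectrumInertToyConcrete`).

§8(d): uses an L-value-free non-vanishing device: NO.
-/

open Matrix NumberField NumberField.IsCMField IsDedekindDomain IsDedekindDomain.HeightOneSpectrum Module
  MulAction
open scoped TensorProduct Pointwise
open Summit.Ventures.HodgeRepro2.T5UnitaryGroupForm Summit.Ventures.HodgeRepro2.T5UnitaryHeckeAdjoint
  Summit.Ventures.HodgeRepro2.T5HeckePermutationModule Summit.Ventures.HodgeRepro2.LevelPositivity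
  Summit.Ventures.HodgeRepro2.T5LevelIdempotent Summit.Ventures.HodgeRepro2.T5StarOfInvolution
  Summit.Ventures.HodgeRepro2.T5FinitePlaceCM Summit.Ventures.HodgeRepro2.T5NonSplitPlaceUnitaryGroup
  Summit.Ventures.HodgeRepro2.T5RecordHyperspecial Summit.Ventures.HodgeRepro2.T5GlobalLatticeAlmostAll
  Summit.Ventures.HodgeRepro2.T5HermitianThreeElements Summit.Ventures.HodgeRepro2.T5GaloisCartanThree
  Summit.Ventures.HodgeRepro2.T5InertDegreeGalois Summit.Ventures.HodgeRepro2.T5InertPlaceCompletion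
  Summit.Ventures.HodgeRepro2.T5InertDegreeAdicCompletion Summit.Ventures.HodgeRepro2.T5InertSatakeTransform
  Summit.Ventures.HodgeRepro2.T5InertSatakeTransformCompletion Summit.Ventures.HodgeRepro2.T5InertUnipotentResidue
  Summit.Ventures.HodgeRepro2.T5InertSphericalSubquotient Summit.Ventures.HodgeRepro2.T5RecordSatakeCell
  Summit.Ventures.HodgeRepro2.T5SplitPlaceUnitaryGroup Summit.Ventures.HodgeRepro2.T5FinitePlaceNormIndex
  Summit.Ventures.HodgeRepro2.T5HermitianLocalIsotropyN3 Summit.Ventures.HodgeRepro2.T5FinitePlaceSplitClassification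
  Summit.Ventures.HodgeRepro2.T5InertDegreeCompletion Summit.Ventures.HodgeRepro2.T5InertPlaceCompletionCells
  Summit.Ventures.HodgeRepro2.T5RecordSatake Summit.Ventures.HodgeRepro2.T5CartanCellsDistinct
  Summit.Ventures.HodgeRepro2.T5RecordSatakeInert Summit.Ventures.HodgeRepro2.T5InertGlobalPrime
  Summit.Ventures.HodgeRepro2.T5CMFieldSquareDatum Summit.Ventures.HodgeRepro2.T5RecordSatakeDegree
  Summit.Ventures.HodgeRepro2.T5RecordSatakeDegreeIntrinsic Summit.Ventures.HodgeRepro2.T5RecordSphericalSpectrum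
  Summit.Ventures.HodgeRepro2.T5RecordSphericalSpectrumIntrinsic Summit.Ventures.HodgeRepro2.T5RecordSatakeToy
  Summit.Ventures.HodgeRepro2.T5RecordSatakeInertToy Summit.Ventures.HodgeRepro2.T5RecordSatakeInertToyDegree
  Summit.Ventures.HodgeRepro2.T5CMCensusToy

namespace Summit.Ventures.HodgeRepro2.T5RecordSphericalSpectrumInertToy

universe uV

section Datum

variable (L : Type*) [Field L] [CharZero L] [IsCyclotomicExtension {2 ^ 2} ℚ L]

/-- `ζ₄² = −1`: the square of a primitive fourth root of unity is a primitive square root of unity, i.e. `−1`. -/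
theorem zeta_sq : (IsCyclotomicExtension.zeta (2 ^ 2) ℚ L) ^ 2 = -1 := by
  have h := IsCyclotomicExtension.zeta_spec (2 ^ 2) ℚ L
  exact IsPrimitiveRoot.eq_neg_one_of_two_right (h.pow (by norm_num) (by norm_num : 2 ^ 2 = 2 * 2))

omit [IsCyclotomicExtension {2 ^ 2} ℚ L] in
/-- `θ = −1` as an element of the maximal real subfield. -/
theorem algebraMap_neg_one : algebraMap (maximalRealSubfield L) L (-1) = -1 := by
  rw [map_neg, map_one]

/-- The datum equation `algebraMap θ = y ^ 2` for `(θ, y) = (−1, ζ₄)`. -/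
theorem neg_one_eq_zeta_sq :
    algebraMap (maximalRealSubfield L) L (-1) = (IsCyclotomicExtension.zeta (2 ^ 2) ℚ L) ^ 2 := by
  rw [algebraMap_neg_one, zeta_sq]

/-- `ζ₄` is not fixed by complex conjugation: under any complex embedding `φ`, `φ(ζ₄)² = −1`, so `φ(ζ₄)` is not
real, so `ζ₄ ∉ L⁺` (`mem_maximalRealSubfield_iff`), so `complexConj ζ₄ ≠ ζ₄` (`complexConj_eq_self_iff`). -/
theorem complexConj_zeta_ne [NumberField L] [IsCMField L] :
    complexConj L (IsCyclotomicExtension.zeta (2 ^ 2) ℚ L) ≠ IsCyclotomicExtension.zeta (2 ^ 2) ℚ L := by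
  intro h
  rw [complexConj_eq_self_iff, mem_maximalRealSubfield_iff] at h
  obtain ⟨φ⟩ := (inferInstance : Nonempty (L →+* ℂ))
  obtain ⟨r, hr⟩ := Complex.conj_eq_iff_real.mp (h φ)
  have h2 : φ (IsCyclotomicExtension.zeta (2 ^ 2) ℚ L) ^ 2 = -1 := by
    rw [← map_pow, zeta_sq, map_neg, map_one]
  rw [hr] at h2
  have h3 : r ^ 2 = -1 := by exact_mod_cast h2
  nlinarith [sq_nonneg r]

end Datum

section Spectrum

variable (L : Type*) [Field L] [CharZero L] [IsCyclotomicExtension {2 ^ 2} ℚ L] [NumberField L] [IsCMField L]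
variable {θ : maximalRealSubfield L} {y : L}
  (hθ : algebraMap (maximalRealSubfield L) L θ = y ^ 2) (hy : complexConj L y ≠ y)
variable {r : ℕ} (l : Fin r → 𝓞 L) (k : Type*) [Field k] [CharZero k] [IsAlgClosed k]

omit [IsCMField L] [CharZero k] [IsAlgClosed k] in
/-- `N(vThreePlus) = 3` read in any field `k`. -/
theorem absNorm_vThreePlus_cast : (Ideal.absNorm (vThreePlus L).asIdeal : k) = 3 := by
  have h : Ideal.absNorm (vThreePlus L).asIdeal = 3 := absNorm_vThreePlus L
  rw [h]
  norm_num

include hθ hy in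
/-- **THE UNRAMIFIED SPECTRUM OF THE RECORD'S PAIR AT THE INERT PLACE `(3)` OF `ℚ(i)`** (file 344's
`exists_mulEquiv_forall_nonempty_equiv_inertSphericalQuot_record_of_staysPrime` with `hmap := map_vThreePlus`,
`H := H₀ = diag(1, 1, −1)`, `q' = 3`): for any datum `(θ, y)` and any generators `l`: there are `u₀ ∈ 𝒪_{ℚ₃}ˣ`,
`Φ : U(J₃(u₀)) ≃* U(1 ⊗ H₀)` matching the hyperspecial subgroups, and a star-fixed uniformiser `ϖ'` of `𝒪_{ℚ₃(i)}`,
such that every irreducible `K_{(3)}`-finite representation of `U(1 ⊗ H₀)` with non-zero finite-dimensional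
`K_{(3)}`-invariants is `≅ (inertSphericalQuot (α · (3²)⁻¹)) ∘ Φ⁻¹` for some `α ≠ 0`. -/
theorem exists_mulEquiv_forall_nonempty_equiv_inertSphericalQuot_record_three
    (hl : Submodule.span (𝓞 (maximalRealSubfield L)) (Set.range l) = ⊤) :
    letI := tensorStarRing L (vThreePlus L)
    letI := starRingOfQuadratic (finrank_eq_two L (vThreePlus L) (T5InertPrimeToy.wThree L) hθ hy
        (not_isSquare_of_staysPrime L (vThreePlus L) (T5InertPrimeToy.wThree L) hθ hy (map_vThreePlus L)))
      (localConj (vThreePlus L) (T5InertPrimeToy.wThree L) hθ.symm (span_pair_eq_top L hy)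
        (not_isSquare_of_staysPrime L (vThreePlus L) (T5InertPrimeToy.wThree L) hθ hy (map_vThreePlus L))
        (complexConj L))
      (localConj_ne_one (vThreePlus L) (T5InertPrimeToy.wThree L) hθ.symm (span_pair_eq_top L hy)
        (not_isSquare_of_staysPrime L (vThreePlus L) (T5InertPrimeToy.wThree L) hθ hy (map_vThreePlus L))
        (complexConj L) (complexConj_apply_eq_neg L hθ hy))
    haveI := isDiscreteValuationRing_integralClosure_adicCompletion (vThreePlus L) (T5InertPrimeToy.wThree L)
    haveI := finite_residueField_integralClosure_adicCompletion (vThreePlus L) (T5InertPrimeToy.wThree L)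
    haveI : IsFractionRing (integralClosure ((vThreePlus L).adicCompletionIntegers (maximalRealSubfield L))
        ((T5InertPrimeToy.wThree L).adicCompletion L)) ((T5InertPrimeToy.wThree L).adicCompletion L) :=
      integralClosure.isFractionRing_of_finite_extension ((vThreePlus L).adicCompletion (maximalRealSubfield L))
        ((T5InertPrimeToy.wThree L).adicCompletion L)
    ∃ (u₀ : ((vThreePlus L).adicCompletionIntegers (maximalRealSubfield L))ˣ)
      (Φ : ↥(formUnitaryGroup (J3 (algebraMap ((vThreePlus L).adicCompletionIntegers (maximalRealSubfield L))
        ((T5InertPrimeToy.wThree L).adicCompletion L)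
        (u₀ : (vThreePlus L).adicCompletionIntegers (maximalRealSubfield L))))) ≃*
        ↥(formUnitaryGroup (tensorGram L (vThreePlus L) (gramToy L))))
      (ϖ' : integralClosure ((vThreePlus L).adicCompletionIntegers (maximalRealSubfield L))
        ((T5InertPrimeToy.wThree L).adicCompletion L))
      (hϖ' : Irreducible ϖ')
      (hs' : star (algebraMap (integralClosure ((vThreePlus L).adicCompletionIntegers (maximalRealSubfield L))
        ((T5InertPrimeToy.wThree L).adicCompletion L)) ((T5InertPrimeToy.wThree L).adicCompletion L) ϖ') =
          algebraMap (integralClosure ((vThreePlus L).adicCompletionIntegers (maximalRealSubfield L))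
            ((T5InertPrimeToy.wThree L).adicCompletion L)) ((T5InertPrimeToy.wThree L).adicCompletion L) ϖ'),
      (∀ g, g ∈ hyperspecialSubgroup
          (integralClosure ((vThreePlus L).adicCompletionIntegers (maximalRealSubfield L))
            ((T5InertPrimeToy.wThree L).adicCompletion L))
          (J3 (algebraMap ((vThreePlus L).adicCompletionIntegers (maximalRealSubfield L))
            ((T5InertPrimeToy.wThree L).adicCompletion L)
            (u₀ : (vThreePlus L).adicCompletionIntegers (maximalRealSubfield L)))) ↔
          Φ g ∈ recordHyperspecial L (vThreePlus L) l (gramToy L)) ∧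
      ∀ {V : Type uV} [AddCommGroup V] [Module k V]
        (ρ : Representation k (↥(formUnitaryGroup (tensorGram L (vThreePlus L) (gramToy L)))) V) [ρ.IsIrreducible],
        KFinite ρ (recordHyperspecial L (vThreePlus L) l (gramToy L)) →
        ∀ [FiniteDimensional k (invariants ρ (recordHyperspecial L (vThreePlus L) l (gramToy L)))],
        invariants ρ (recordHyperspecial L (vThreePlus L) l (gramToy L)) ≠ ⊥ →
        ∃ α : k, α ≠ 0 ∧ Nonempty (ρ.Equiv (comp Φ.symm
          (inertSphericalQuot
            (hstar_of_star_eq (localConj (vThreePlus L) (T5InertPrimeToy.wThree L) hθ.symm (span_pair_eq_top L hy)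
              (not_isSquare_of_staysPrime L (vThreePlus L) (T5InertPrimeToy.wThree L) hθ hy (map_vThreePlus L))
              (complexConj L))
              (fun x => by
                rw [star_p8_eq_star L (vThreePlus L) (T5InertPrimeToy.wThree L) hθ hy
                  (not_isSquare_of_staysPrime L (vThreePlus L) (T5InertPrimeToy.wThree L) hθ hy
                    (map_vThreePlus L))]
                rfl))
            (algebraMap ((vThreePlus L).adicCompletionIntegers (maximalRealSubfield L))
              ((T5InertPrimeToy.wThree L).adicCompletion L)
              (u₀ : (vThreePlus L).adicCompletionIntegers (maximalRealSubfield L)))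
            (star_algebraMap_of_star_eq (localConj (vThreePlus L) (T5InertPrimeToy.wThree L) hθ.symm
              (span_pair_eq_top L hy)
              (not_isSquare_of_staysPrime L (vThreePlus L) (T5InertPrimeToy.wThree L) hθ hy (map_vThreePlus L))
              (complexConj L))
              (fun x => by
                rw [star_p8_eq_star L (vThreePlus L) (T5InertPrimeToy.wThree L) hθ hy
                  (not_isSquare_of_staysPrime L (vThreePlus L) (T5InertPrimeToy.wThree L) hθ hy
                    (map_vThreePlus L))]
                rfl)
              (u₀ : (vThreePlus L).adicCompletionIntegers (maximalRealSubfield L)))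
            (algebraMap_unit_ne_zero (F := (vThreePlus L).adicCompletion (maximalRealSubfield L)) u₀)
            (isInteger_algebraMap (u₀ : (vThreePlus L).adicCompletionIntegers (maximalRealSubfield L)))
            (isInteger_algebraMap_unit_inv u₀) hϖ' hs' k (α * ((3 : k) ^ 2)⁻¹)))) :=
  exists_mulEquiv_forall_nonempty_equiv_inertSphericalQuot_record_of_staysPrime L (vThreePlus L)
    (T5InertPrimeToy.wThree L) hθ hy (map_vThreePlus L) l k 3 (absNorm_vThreePlus_cast L k) hl
    gramToy_isHermitian isUnit_det_gramToy (notMem_badSet_gramToy _)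

/-- **THE SAME WITH THE EXPLICIT DATUM `(θ, y) = (−1, ζ₄)`** of `ℚ(i)` (`neg_one_eq_zeta_sq`, `complexConj_zeta_ne`):
the unramified spectrum of `(U(1 ⊗ H₀), K_{(3)})` at the inert place `(3)` of `ℚ(i)`, Satake parameter
`α · (3²)⁻¹`, for any generators `l` of `𝓞_{ℚ(i)}` over `𝓞_{ℚ(i)⁺}`. -/
theorem exists_mulEquiv_forall_nonempty_equiv_inertSphericalQuot_record_three_zeta
    (hl : Submodule.span (𝓞 (maximalRealSubfield L)) (Set.range l) = ⊤) :
    letI := tensorStarRing L (vThreePlus L)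
    letI := starRingOfQuadratic (finrank_eq_two L (vThreePlus L) (T5InertPrimeToy.wThree L) (neg_one_eq_zeta_sq L) (complexConj_zeta_ne L)
        (not_isSquare_of_staysPrime L (vThreePlus L) (T5InertPrimeToy.wThree L) (neg_one_eq_zeta_sq L) (complexConj_zeta_ne L) (map_vThreePlus L)))
      (localConj (vThreePlus L) (T5InertPrimeToy.wThree L) (neg_one_eq_zeta_sq L).symm (span_pair_eq_top L (complexConj_zeta_ne L))
        (not_isSquare_of_staysPrime L (vThreePlus L) (T5InertPrimeToy.wThree L) (neg_one_eq_zeta_sq L) (complexConj_zeta_ne L) (map_vThreePlus L))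
        (complexConj L))
      (localConj_ne_one (vThreePlus L) (T5InertPrimeToy.wThree L) (neg_one_eq_zeta_sq L).symm (span_pair_eq_top L (complexConj_zeta_ne L))
        (not_isSquare_of_staysPrime L (vThreePlus L) (T5InertPrimeToy.wThree L) (neg_one_eq_zeta_sq L) (complexConj_zeta_ne L) (map_vThreePlus L))
        (complexConj L) (complexConj_apply_eq_neg L (neg_one_eq_zeta_sq L) (complexConj_zeta_ne L)))
    haveI := isDiscreteValuationRing_integralClosure_adicCompletion (vThreePlus L) (T5InertPrimeToy.wThree L)
    haveI := finite_residueField_integralClosure_adicCompletion (vThreePlus L) (T5InertPrimeToy.wThree L)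
    haveI : IsFractionRing (integralClosure ((vThreePlus L).adicCompletionIntegers (maximalRealSubfield L))
        ((T5InertPrimeToy.wThree L).adicCompletion L)) ((T5InertPrimeToy.wThree L).adicCompletion L) :=
      integralClosure.isFractionRing_of_finite_extension ((vThreePlus L).adicCompletion (maximalRealSubfield L))
        ((T5InertPrimeToy.wThree L).adicCompletion L)
    ∃ (u₀ : ((vThreePlus L).adicCompletionIntegers (maximalRealSubfield L))ˣ)
      (Φ : ↥(formUnitaryGroup (J3 (algebraMap ((vThreePlus L).adicCompletionIntegers (maximalRealSubfield L))
        ((T5InertPrimeToy.wThree L).adicCompletion L)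
        (u₀ : (vThreePlus L).adicCompletionIntegers (maximalRealSubfield L))))) ≃*
        ↥(formUnitaryGroup (tensorGram L (vThreePlus L) (gramToy L))))
      (ϖ' : integralClosure ((vThreePlus L).adicCompletionIntegers (maximalRealSubfield L))
        ((T5InertPrimeToy.wThree L).adicCompletion L))
      (hϖ' : Irreducible ϖ')
      (hs' : star (algebraMap (integralClosure ((vThreePlus L).adicCompletionIntegers (maximalRealSubfield L))
        ((T5InertPrimeToy.wThree L).adicCompletion L)) ((T5InertPrimeToy.wThree L).adicCompletion L) ϖ') =
          algebraMap (integralClosure ((vThreePlus L).adicCompletionIntegers (maximalRealSubfield L))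
            ((T5InertPrimeToy.wThree L).adicCompletion L)) ((T5InertPrimeToy.wThree L).adicCompletion L) ϖ'),
      (∀ g, g ∈ hyperspecialSubgroup
          (integralClosure ((vThreePlus L).adicCompletionIntegers (maximalRealSubfield L))
            ((T5InertPrimeToy.wThree L).adicCompletion L))
          (J3 (algebraMap ((vThreePlus L).adicCompletionIntegers (maximalRealSubfield L))
            ((T5InertPrimeToy.wThree L).adicCompletion L)
            (u₀ : (vThreePlus L).adicCompletionIntegers (maximalRealSubfield L)))) ↔
          Φ g ∈ recordHyperspecial L (vThreePlus L) l (gramToy L)) ∧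
      ∀ {V : Type uV} [AddCommGroup V] [Module k V]
        (ρ : Representation k (↥(formUnitaryGroup (tensorGram L (vThreePlus L) (gramToy L)))) V) [ρ.IsIrreducible],
        KFinite ρ (recordHyperspecial L (vThreePlus L) l (gramToy L)) →
        ∀ [FiniteDimensional k (invariants ρ (recordHyperspecial L (vThreePlus L) l (gramToy L)))],
        invariants ρ (recordHyperspecial L (vThreePlus L) l (gramToy L)) ≠ ⊥ →
        ∃ α : k, α ≠ 0 ∧ Nonempty (ρ.Equiv (comp Φ.symm
          (inertSphericalQuot
            (hstar_of_star_eq (localConj (vThreePlus L) (T5InertPrimeToy.wThree L) (neg_one_eq_zeta_sq L).symm (span_pair_eq_top L (complexConj_zeta_ne L))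
              (not_isSquare_of_staysPrime L (vThreePlus L) (T5InertPrimeToy.wThree L) (neg_one_eq_zeta_sq L) (complexConj_zeta_ne L) (map_vThreePlus L))
              (complexConj L))
              (fun x => by
                rw [star_p8_eq_star L (vThreePlus L) (T5InertPrimeToy.wThree L) (neg_one_eq_zeta_sq L) (complexConj_zeta_ne L)
                  (not_isSquare_of_staysPrime L (vThreePlus L) (T5InertPrimeToy.wThree L) (neg_one_eq_zeta_sq L) (complexConj_zeta_ne L)
                    (map_vThreePlus L))]
                rfl))
            (algebraMap ((vThreePlus L).adicCompletionIntegers (maximalRealSubfield L))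
              ((T5InertPrimeToy.wThree L).adicCompletion L)
              (u₀ : (vThreePlus L).adicCompletionIntegers (maximalRealSubfield L)))
            (star_algebraMap_of_star_eq (localConj (vThreePlus L) (T5InertPrimeToy.wThree L) (neg_one_eq_zeta_sq L).symm
              (span_pair_eq_top L (complexConj_zeta_ne L))
              (not_isSquare_of_staysPrime L (vThreePlus L) (T5InertPrimeToy.wThree L) (neg_one_eq_zeta_sq L) (complexConj_zeta_ne L) (map_vThreePlus L))
              (complexConj L))
              (fun x => by
                rw [star_p8_eq_star L (vThreePlus L) (T5InertPrimeToy.wThree L) (neg_one_eq_zeta_sq L) (complexConj_zeta_ne L)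
                  (not_isSquare_of_staysPrime L (vThreePlus L) (T5InertPrimeToy.wThree L) (neg_one_eq_zeta_sq L) (complexConj_zeta_ne L)
                    (map_vThreePlus L))]
                rfl)
              (u₀ : (vThreePlus L).adicCompletionIntegers (maximalRealSubfield L)))
            (algebraMap_unit_ne_zero (F := (vThreePlus L).adicCompletion (maximalRealSubfield L)) u₀)
            (isInteger_algebraMap (u₀ : (vThreePlus L).adicCompletionIntegers (maximalRealSubfield L)))
            (isInteger_algebraMap_unit_inv u₀) hϖ' hs' k (α * ((3 : k) ^ 2)⁻¹)))) :=
  exists_mulEquiv_forall_nonempty_equiv_inertSphericalQuot_record_three L (neg_one_eq_zeta_sq L)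
    (complexConj_zeta_ne L) l k hl

/-- **With the generators supplied** (file 235's `exists_fin_span_eq_top`): the whole hypothesis set of file 344's
statement is inhabited on `ℚ(i)` at `3` with the explicit datum `(−1, ζ₄)` — generators `l` exist with the
unramified spectrum of `(U(1 ⊗ H₀), K_{(3)})` as above. -/
theorem exists_generators_and_mulEquiv_forall_nonempty_equiv_inertSphericalQuot_record_three_zeta :
    ∃ (r : ℕ) (l : Fin r → 𝓞 L), Submodule.span (𝓞 (maximalRealSubfield L)) (Set.range l) = ⊤ ∧
      (letI := tensorStarRing L (vThreePlus L)
      letI := starRingOfQuadratic (finrank_eq_two L (vThreePlus L) (T5InertPrimeToy.wThree L) (neg_one_eq_zeta_sq L) (complexConj_zeta_ne L)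
          (not_isSquare_of_staysPrime L (vThreePlus L) (T5InertPrimeToy.wThree L) (neg_one_eq_zeta_sq L) (complexConj_zeta_ne L) (map_vThreePlus L)))
        (localConj (vThreePlus L) (T5InertPrimeToy.wThree L) (neg_one_eq_zeta_sq L).symm (span_pair_eq_top L (complexConj_zeta_ne L))
          (not_isSquare_of_staysPrime L (vThreePlus L) (T5InertPrimeToy.wThree L) (neg_one_eq_zeta_sq L) (complexConj_zeta_ne L) (map_vThreePlus L))
          (complexConj L))
        (localConj_ne_one (vThreePlus L) (T5InertPrimeToy.wThree L) (neg_one_eq_zeta_sq L).symm (span_pair_eq_top L (complexConj_zeta_ne L))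
          (not_isSquare_of_staysPrime L (vThreePlus L) (T5InertPrimeToy.wThree L) (neg_one_eq_zeta_sq L) (complexConj_zeta_ne L) (map_vThreePlus L))
          (complexConj L) (complexConj_apply_eq_neg L (neg_one_eq_zeta_sq L) (complexConj_zeta_ne L)))
      haveI := isDiscreteValuationRing_integralClosure_adicCompletion (vThreePlus L) (T5InertPrimeToy.wThree L)
      haveI := finite_residueField_integralClosure_adicCompletion (vThreePlus L) (T5InertPrimeToy.wThree L)
      haveI : IsFractionRing (integralClosure ((vThreePlus L).adicCompletionIntegers (maximalRealSubfield L))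
          ((T5InertPrimeToy.wThree L).adicCompletion L)) ((T5InertPrimeToy.wThree L).adicCompletion L) :=
        integralClosure.isFractionRing_of_finite_extension ((vThreePlus L).adicCompletion (maximalRealSubfield L))
          ((T5InertPrimeToy.wThree L).adicCompletion L)
      ∃ (u₀ : ((vThreePlus L).adicCompletionIntegers (maximalRealSubfield L))ˣ)
        (Φ : ↥(formUnitaryGroup (J3 (algebraMap ((vThreePlus L).adicCompletionIntegers (maximalRealSubfield L))
          ((T5InertPrimeToy.wThree L).adicCompletion L)
          (u₀ : (vThreePlus L).adicCompletionIntegers (maximalRealSubfield L))))) ≃*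
          ↥(formUnitaryGroup (tensorGram L (vThreePlus L) (gramToy L))))
        (ϖ' : integralClosure ((vThreePlus L).adicCompletionIntegers (maximalRealSubfield L))
          ((T5InertPrimeToy.wThree L).adicCompletion L))
        (hϖ' : Irreducible ϖ')
        (hs' : star (algebraMap (integralClosure ((vThreePlus L).adicCompletionIntegers (maximalRealSubfield L))
          ((T5InertPrimeToy.wThree L).adicCompletion L)) ((T5InertPrimeToy.wThree L).adicCompletion L) ϖ') =
            algebraMap (integralClosure ((vThreePlus L).adicCompletionIntegers (maximalRealSubfield L))
              ((T5InertPrimeToy.wThree L).adicCompletion L)) ((T5InertPrimeToy.wThree L).adicCompletion L) ϖ'),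
        (∀ g, g ∈ hyperspecialSubgroup
            (integralClosure ((vThreePlus L).adicCompletionIntegers (maximalRealSubfield L))
              ((T5InertPrimeToy.wThree L).adicCompletion L))
            (J3 (algebraMap ((vThreePlus L).adicCompletionIntegers (maximalRealSubfield L))
              ((T5InertPrimeToy.wThree L).adicCompletion L)
              (u₀ : (vThreePlus L).adicCompletionIntegers (maximalRealSubfield L)))) ↔
            Φ g ∈ recordHyperspecial L (vThreePlus L) l (gramToy L)) ∧
        ∀ {V : Type uV} [AddCommGroup V] [Module k V]
          (ρ : Representation k (↥(formUnitaryGroup (tensorGram L (vThreePlus L) (gramToy L)))) V) [ρ.IsIrreducible],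
          KFinite ρ (recordHyperspecial L (vThreePlus L) l (gramToy L)) →
          ∀ [FiniteDimensional k (invariants ρ (recordHyperspecial L (vThreePlus L) l (gramToy L)))],
          invariants ρ (recordHyperspecial L (vThreePlus L) l (gramToy L)) ≠ ⊥ →
          ∃ α : k, α ≠ 0 ∧ Nonempty (ρ.Equiv (comp Φ.symm
            (inertSphericalQuot
              (hstar_of_star_eq (localConj (vThreePlus L) (T5InertPrimeToy.wThree L) (neg_one_eq_zeta_sq L).symm (span_pair_eq_top L (complexConj_zeta_ne L))
                (not_isSquare_of_staysPrime L (vThreePlus L) (T5InertPrimeToy.wThree L) (neg_one_eq_zeta_sq L) (complexConj_zeta_ne L) (map_vThreePlus L))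
                (complexConj L))
                (fun x => by
                  rw [star_p8_eq_star L (vThreePlus L) (T5InertPrimeToy.wThree L) (neg_one_eq_zeta_sq L) (complexConj_zeta_ne L)
                    (not_isSquare_of_staysPrime L (vThreePlus L) (T5InertPrimeToy.wThree L) (neg_one_eq_zeta_sq L) (complexConj_zeta_ne L)
                      (map_vThreePlus L))]
                  rfl))
              (algebraMap ((vThreePlus L).adicCompletionIntegers (maximalRealSubfield L))
                ((T5InertPrimeToy.wThree L).adicCompletion L)
                (u₀ : (vThreePlus L).adicCompletionIntegers (maximalRealSubfield L)))
              (star_algebraMap_of_star_eq (localConj (vThreePlus L) (T5InertPrimeToy.wThree L) (neg_one_eq_zeta_sq L).symm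
                (span_pair_eq_top L (complexConj_zeta_ne L))
                (not_isSquare_of_staysPrime L (vThreePlus L) (T5InertPrimeToy.wThree L) (neg_one_eq_zeta_sq L) (complexConj_zeta_ne L) (map_vThreePlus L))
                (complexConj L))
                (fun x => by
                  rw [star_p8_eq_star L (vThreePlus L) (T5InertPrimeToy.wThree L) (neg_one_eq_zeta_sq L) (complexConj_zeta_ne L)
                    (not_isSquare_of_staysPrime L (vThreePlus L) (T5InertPrimeToy.wThree L) (neg_one_eq_zeta_sq L) (complexConj_zeta_ne L)
                      (map_vThreePlus L))]
                  rfl)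
                (u₀ : (vThreePlus L).adicCompletionIntegers (maximalRealSubfield L)))
              (algebraMap_unit_ne_zero (F := (vThreePlus L).adicCompletion (maximalRealSubfield L)) u₀)
              (isInteger_algebraMap (u₀ : (vThreePlus L).adicCompletionIntegers (maximalRealSubfield L)))
              (isInteger_algebraMap_unit_inv u₀) hϖ' hs' k (α * ((3 : k) ^ 2)⁻¹))))) :=
  (exists_fin_span_eq_top L).elim fun r h => h.elim fun l hl =>
    ⟨r, l, hl, exists_mulEquiv_forall_nonempty_equiv_inertSphericalQuot_record_three_zeta L l k hl⟩

end Spectrum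

end Summit.Ventures.HodgeRepro2.T5RecordSphericalSpectrumInertToy
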